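import Summits.PneNP.PneNP.Theorems.RamseyUncertifiableResolutionUncertaintyPinMonotoneWalk

/-!
# PIN-MONOTONE (dag-like) refutations of the unary clique CNF enumerate cliques, II: the injection — item
# stmt-PneNP-9816 `RamseyUncertifiable.ResolutionUncertainty` (support); the typed sub-target
# `PinMonotoneCoreHardness` of the line `box-dag-self-gadget-lifting`

`pinMonotone_cliqueCNF_length_ge_card_cliqueFinset`: every PIN-MONOTONE resolution refutation `π` of the unary
`Clique(G, k)` — dag-like, no tree-likeness assumed (`IsPinMonotone`, file I) — has at least `#(t-cliques of G)`
lines, for every `t`.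

Proof (the Delayer injection of `…TreeLike.lean`, without trees; walk lemmas in file I). Walk down `π` with Delayer
`Q` (a clique): it halts on a block axiom and its final record pins exactly `Q` (`TreeLike.pins_leaf`). Let
`arrival Q` be the first time the walk sits on its final line and `lastLine Q` the line just before (the root if the
walk never moves). Before arrival every visited line is non-initial (`rule_ne_initial_of_lt_arrival`), so negative
literals persist up to `lastLine Q` (`neg_persist`); every pin of the final record was acquired at a resolution step
entering a line that contains its negation (`TreeLike.step_new_true`), necessarily before arrival (the final block
axiom has no negative literal, `TreeLike.final_no_neg`); hence the negative literals of the clause at `lastLine Q` are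
EXACTLY the pin variables of `Q` (`decode_lastLine`: read modulo `n` they give `Q`), and `Q ↦ lastLine Q` is injective.
-/

set_option linter.dupNamespace false

namespace Summit.PneNP.PneNP.Theorems.RamseyUncertifiableResolutionUncertainty

open Literature.Computability.Complexity Literature.Computability.MetaComplexity
open Summit.PneNP.PneNP.Theorems.RegularResolutionRung.Negative (cliqueCNF)

namespace TreeLike

/-! ## The last non-initial line of the walk and the injection -/

section Injection

variable {n k : ℕ} (G : SimpleGraph (Fin n)) [DecidableRel G.Adj] {π : List (ResLine ℕ)} {r : ℕ}

/-- The ARRIVAL time of Delayer `Q`'s walk: the first time it sits on its final line. -/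
noncomputable def arrival (n k : ℕ) (π : List (ResLine ℕ)) (r : ℕ) (Q : Finset (Fin n)) : ℕ :=
  Nat.find (⟨π.length, rfl⟩ : ∃ s, (run π (answer n k Q) r s).1 = (run π (answer n k Q) r π.length).1)

/-- The LAST NON-INITIAL line of Delayer `Q`'s walk (the root if the walk never moves). -/
noncomputable def lastLine (n k : ℕ) (π : List (ResLine ℕ)) (r : ℕ) (Q : Finset (Fin n)) : ℕ :=
  (run π (answer n k Q) r (arrival n k π r Q - 1)).1

/-- The arrival time is a time at which the walk sits on its final line. -/
theorem arrival_spec (Q : Finset (Fin n)) :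
    (run π (answer n k Q) r (arrival n k π r Q)).1 = (run π (answer n k Q) r π.length).1 :=
  Nat.find_spec (⟨π.length, rfl⟩ : ∃ s, (run π (answer n k Q) r s).1 = (run π (answer n k Q) r π.length).1)

/-- The walk has arrived by time `π.length`. -/
theorem arrival_le (Q : Finset (Fin n)) : arrival n k π r Q ≤ π.length :=
  Nat.find_min' _ rfl

/-- Before arrival the walk is not on its final line. -/
theorem ne_final_of_lt_arrival (Q : Finset (Fin n)) {s : ℕ} (hs : s < arrival n k π r Q) :
    (run π (answer n k Q) r s).1 ≠ (run π (answer n k Q) r π.length).1 :=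
  Nat.find_min (⟨π.length, rfl⟩ : ∃ s, (run π (answer n k Q) r s).1 = (run π (answer n k Q) r π.length).1) hs

variable (hπ : IsResDerivation (cliqueCNF n k fun u v => decide (G.Adj u v)) π) (hr : r < π.length)
include hπ hr

/-- Before arrival the walk sits on non-initial lines. -/
theorem rule_ne_initial_of_lt_arrival (Q : Finset (Fin n)) {s : ℕ} (hs : s < arrival n k π r Q) :
    (π[(run π (answer n k Q) r s).1]'(run_fst_lt _ hπ hr s)).rule ≠ .initial := by
  intro hinit
  apply ne_final_of_lt_arrival Q hs
  obtain ⟨d, hd⟩ := Nat.exists_eq_add_of_le (le_trans hs.le (arrival_le Q))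
  rw [hd, run_const_of_initial (answer n k Q) s (run_fst_lt _ hπ hr s) hinit d]

/-- From arrival on, the walk is constant (it sits on its final, initial, line). -/
theorem run_eq_final_of_arrival_le (Q : Finset (Fin n)) {s : ℕ} (hs : arrival n k π r Q ≤ s) :
    run π (answer n k Q) r s = run π (answer n k Q) r π.length := by
  -- the final line is initial, so is the arrival line (same line); constancy from arrival in both directions
  have hfix := step_run_length (answer n k Q) hπ hr
  have hinitF := rule_initial_of_step_eq (answer n k Q) hπ _ (run_fst_lt _ hπ hr _) hfix
  have hinitA : (π[(run π (answer n k Q) r (arrival n k π r Q)).1]'(run_fst_lt _ hπ hr _)).rule = .initial := by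
    have := arrival_spec (π := π) (r := r) (k := k) Q
    simp only [this]; exact hinitF
  obtain ⟨d, rfl⟩ := Nat.exists_eq_add_of_le hs
  obtain ⟨e, he⟩ := Nat.exists_eq_add_of_le (arrival_le (π := π) (r := r) (k := k) Q)
  rw [run_const_of_initial (answer n k Q) _ (run_fst_lt _ hπ hr _) hinitA d]
  conv_rhs => rw [he, run_const_of_initial (answer n k Q) _ (run_fst_lt _ hπ hr _) hinitA e]

/-- **Negative literals persist until the last non-initial line** (pin-monotonicity along the walk). -/
theorem neg_persist (hmono : IsPinMonotone π) (Q : Finset (Fin n)) {s : ℕ} (d : ℕ)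
    (hsd : s + d < arrival n k π r Q) {l : Literal ℕ} (hl2 : l.2 = false)
    (hl : l ∈ (π[(run π (answer n k Q) r s).1]'(run_fst_lt _ hπ hr s)).clause) :
    l ∈ (π[(run π (answer n k Q) r (s + d)).1]'(run_fst_lt _ hπ hr (s + d))).clause := by
  induction d with
  | zero => exact hl
  | succ d ih =>
    have ih := ih (by omega)
    have hni := rule_ne_initial_of_lt_arrival G hπ hr Q hsd
    exact step_neg_subset (answer n k Q) hπ hmono (run π (answer n k Q) r (s + d)) (run_fst_lt _ hπ hr _) rfl
      (run_fst_lt _ hπ hr (s + d + 1)) hni l ih hl2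

/-- **Every pin of the final record is a negative literal of the last non-initial clause.** -/
theorem neg_mem_lastLine (hroot : (π[r]'hr).clause = ∅) (hmono : IsPinMonotone π) {Q : Finset (Fin n)}
    (hQ : G.IsClique (Q : Set (Fin n))) {w : ℕ} (hw : (run π (answer n k Q) r π.length).2 w = some true) :
    (w, false) ∈ (π[lastLine n k π r Q]'(run_fst_lt _ hπ hr _)).clause := by
  classical
  -- first time `w` is recorded `true`
  have hex : ∃ s, (run π (answer n k Q) r s).2 w = some true := ⟨π.length, hw⟩
  set s₀ := Nat.find hex with hs₀
  have hs₀spec : (run π (answer n k Q) r s₀).2 w = some true := Nat.find_spec hex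
  have hs₀pos : s₀ ≠ 0 := by
    intro h0
    rw [h0] at hs₀spec
    simp [run] at hs₀spec
  obtain ⟨s₁, hs₁⟩ : ∃ s₁, s₀ = s₁ + 1 := Nat.exists_eq_succ_of_ne_zero hs₀pos
  have hold : (run π (answer n k Q) r s₁).2 w ≠ some true := Nat.find_min hex (by omega)
  rw [hs₁] at hs₀spec
  have hnew := step_new_true (answer n k Q) hπ (run π (answer n k Q) r s₁) (run_fst_lt _ hπ hr s₁) rfl rfl
    (run_fst_lt _ hπ hr (s₁ + 1)) hold hs₀spec
  -- `s₁ + 1` is before arrival: otherwise the line there is the final block axiom, which has no negative literal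
  have hlt : s₁ + 1 < arrival n k π r Q := by
    by_contra hge
    push Not at hge
    have heq := run_eq_final_of_arrival_le G hπ hr Q hge
    have hpos := final_no_neg G hπ hr hroot hQ (w, false) (by simp only [← heq]; exact hnew)
    exact Bool.false_ne_true hpos
  obtain ⟨d, hd⟩ := Nat.exists_eq_add_of_le (Nat.le_sub_one_of_lt hlt)
  unfold lastLine
  rw [hd]
  exact neg_persist G hπ hr hmono Q d (by omega) rfl hnew

/-- **The last non-initial clause decodes `Q`**: its negative literals, read modulo `n`, are exactly `Q`. -/
theorem decode_lastLine (hroot : (π[r]'hr).clause = ∅) (hmono : IsPinMonotone π) {Q : Finset (Fin n)}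
    (hQ : G.IsClique (Q : Set (Fin n))) :
    (((π[lastLine n k π r Q]'(run_fst_lt _ hπ hr _)).clause.filter fun l => l.2 = false).image
        fun l => l.1 % n) = Q.image Fin.val := by
  classical
  ext x
  simp only [Finset.mem_image, Finset.mem_filter]
  constructor
  · rintro ⟨l, ⟨hl, hl2⟩, rfl⟩
    -- the record at that time falsifies the clause: `l.1` is recorded `true`, hence a block variable of `Q`
    have hf := run_falsifies (answer n k Q) hπ hr hroot (arrival n k π r Q - 1) l hl
    rw [hl2] at hf
    obtain ⟨i, -, v, hv, hvQ⟩ := run_true_form (r := r) (π := π) Q _ hf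
    refine ⟨v, hvQ, ?_⟩
    rw [hv, Nat.add_mod, Nat.mul_mod_left, Nat.zero_add, Nat.mod_mod, Nat.mod_eq_of_lt v.isLt]
  · rintro ⟨v, hvQ, rfl⟩
    -- `v` is pinned in the final record (`pins_leaf`), so its pin variable sits negatively in the last clause
    have hpins := pins_leaf G hπ hr hroot hQ
    have hv : v ∈ pins n k (run π (answer n k Q) r π.length).2 := by rw [hpins]; exact hvQ
    simp only [pins, Finset.mem_filter, Finset.mem_univ, true_and] at hv
    obtain ⟨i, -, hi⟩ := hv
    refine ⟨(i * n + (v : ℕ), false), ⟨neg_mem_lastLine G hπ hr hroot hmono hQ hi, rfl⟩, ?_⟩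
    show (i * n + (v : ℕ)) % n = (v : ℕ)
    rw [Nat.add_mod, Nat.mul_mod_left, Nat.zero_add, Nat.mod_mod, Nat.mod_eq_of_lt v.isLt]

end Injection

/-! ## The theorem -/

section Main

variable {n k : ℕ} (G : SimpleGraph (Fin n)) [DecidableRel G.Adj] {π : List (ResLine ℕ)}

/-- **Pin-monotone refutations of `Clique(G, k)` are at least as long as any family of cliques of `G` is large**:
`Q ↦ lastLine Q` is injective on cliques and lands in the lines of `π`. No tree-likeness is assumed. -/
theorem card_le_length_of_isPinMonotone (hπ : IsResRefutation (cliqueCNF n k fun u v => decide (G.Adj u v)) π)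
    (hmono : IsPinMonotone π) (S : Finset (Finset (Fin n))) (hS : ∀ Q ∈ S, G.IsClique (Q : Set (Fin n))) :
    S.card ≤ π.length := by
  classical
  obtain ⟨hder, l, hl, hle⟩ := hπ
  obtain ⟨r, hr, rfl⟩ := List.getElem_of_mem hl
  calc S.card ≤ (Finset.range π.length).card := by
        refine Finset.card_le_card_of_injOn (lastLine n k π r) (fun Q _ => ?_) ?_
        · exact Finset.mem_coe.2 (Finset.mem_range.2 (run_fst_lt _ hder hr _))
        · intro Q hQ Q' hQ' hQQ'
          have h1 := decode_lastLine G hder hr hle hmono (hS Q hQ)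
          have h2 := decode_lastLine G hder hr hle hmono (hS Q' hQ')
          have key : ∀ {a b : ℕ} (ha : a < π.length) (hb : b < π.length), a = b →
              ((π[a]'ha).clause.filter (fun l => l.2 = false)).image (fun l => l.1 % n) =
              ((π[b]'hb).clause.filter (fun l => l.2 = false)).image (fun l => l.1 % n) := by
            intro a b ha hb hab; subst hab; rfl
          have h12 : Q.image Fin.val = Q'.image Fin.val := by
            rw [← h1, ← h2]
            exact key _ _ hQQ'
          exact Finset.image_injective Fin.val_injective h12
    _ = π.length := Finset.card_range _

end Main

end TreeLike

/-- **Pin-monotone (dag-like) refutations of `Clique(G, k)` enumerate cliques.** For every graph `G` on `Fin n`, every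
`k`, every PIN-MONOTONE resolution refutation `π` of the unary `Clique(G, k)` and every `t`, the number of `t`-cliques of
`G` is at most the number of lines of `π`. Tree-likeness is NOT assumed: this is a dag-like subsystem (the typed
sub-target of the line `box-dag-self-gadget-lifting`), and the bound is the same as for tree-like refutations
(`treelike_cliqueCNF_length_ge_card_cliqueFinset`). -/
theorem pinMonotone_cliqueCNF_length_ge_card_cliqueFinset :
    ∀ {n k : ℕ} (G : SimpleGraph (Fin n)) [DecidableRel G.Adj] (π : List (ResLine ℕ)) (t : ℕ),
      IsResRefutation (cliqueCNF n k fun u v => decide (G.Adj u v)) π → IsPinMonotone π →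
        (G.cliqueFinset t).card ≤ π.length := by
  intro n k G _ π t hπ hmono
  exact TreeLike.card_le_length_of_isPinMonotone G hπ hmono _
    fun _ hQ => (SimpleGraph.mem_cliqueFinset_iff.1 hQ).isClique

end Summit.PneNP.PneNP.Theorems.RamseyUncertifiableResolutionUncertainty
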